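import Literature.AlgebraicGeometry.Motives.Delsarte
import Literature.AlgebraicGeometry.Motives.ProjectiveSpaceRingPoints
import Literature.AlgebraicGeometry.Motives.HypersurfaceFieldPoints
import Mathlib.LinearAlgebra.Matrix.Adjugate
import Mathlib.FieldTheory.IsAlgClosed.AlgebraicClosure
import Mathlib.RingTheory.GradedAlgebra.Radical
import HarnessLib

/-!
# The Fermat cover of a Delsarte hypersurface (discharge of `DelsarteFermatCover`)

We prove the named fact `Literature.AlgebraicGeometry.Motives.DelsarteFermatCover` of
`Motives/Delsarte` (Shioda 1986; Bini 2011, Thm. 3.1 = Kelly 2013, Thm. 3.1; Kloosterman 2017, §2):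
for `A ∈ M_{n+2}(ℤ_{≥0})` with constant row sums `e > 0`, a zero in each column and an integral
matrix `B` with `A B = d · 1` (`d > 0`), the Shioda map `φ_B : y ↦ x`, `xⱼ = ∏ₖ yₖ ^ bⱼₖ`
(Kelly 2013, §3, p. 8: "the Shioda maps restrict to rational maps `X_{dI} ⇢ X_A`") is a dominant
rational map of `ℂ`-schemes from the Fermat variety `Y = V₊(Σ yᵢᵈ) ⊆ ℙⁿ⁺¹_ℂ` to the Delsarte
hypersurface `X = V₊(F_A) ⊆ ℙⁿ⁺¹_ℂ`.

## Proof (scheme-theoretic unfolding of Kelly §3 / Kloosterman §2, Lemma 2.4)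

* The map is defined on the torus part `U = Y ∩ D₊(∏ yⱼ)` of `Y`: on the chart
  `D₊(t) = Spec k[y]_{(t)}`, `t = ∏ yⱼ`, the Laurent monomials `vⱼ = ∏ₖ (yₖ/y₀) ^ bⱼₖ` (all rows of
  `B` have the same sum `δ = d/e`, so `[v] = [y^B]`) are units and define a `k`-morphism
  `Spec k[y]_{(t)} → ℙⁿ⁺¹_k` (`ProjectiveSpace.vecChartPoint` of `Motives/ProjectiveSpaceRingPoints`);
  composed with `U → D₊(t)` it sends an `L`-point `[w]` of `U` to `[w^B]`
  (`FermatCover.comp_shioda_eq`), hence lands in `V₊(F_A)` because `F_A(w^B) = Σ wᵢᵈ = 0`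
  (`Delsarte.bind₁_polynomial` in point form), and so factors through the reduced closed subscheme `X`
  (`liftOfRangeSubset` of `Motives/HypersurfaceFieldPoints`, Hartshorne II Ex. 3.11(d)).
* `U` is dense in `Y` and `X ∩ D₊(∏ xⱼ)` is dense in `X`: for a form `F` divisible by no variable,
  `V₊(F) ∩ D₊(∏ xⱼ)` is dense in `V₊(F)` (every point specialises from the generic point of a
  component `V₊(G)`, `G` a prime factor of `F`, and `G ∤ ∏ xⱼ`); no variable divides the Fermat form,
  nor `F_A` when each column of `A` has a zero (evaluate at `𝟙 - eⱼ`).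
* Dominance (Kloosterman 2017, after Lemma 2.8: `Y* → X*` is surjective): every point `x` of
  `X ∩ D₊(∏ xⱼ)` is hit — over the algebraic closure `L` of `κ(x)` write `x = [z]` with all `zⱼ ≠ 0`,
  solve `w^B = z` in `(Lˣ)ⁿ⁺²` (`B · adj B = det B · 1` and `|det B|`-th roots), note
  `Σ wᵢᵈ = F_A(z) = 0`, so `[w]` is an `L`-point of `U` mapping to `x`.

## References

* T. L. Kelly, *Berglund–Hübsch–Krawitz mirrors via Shioda maps*, Adv. Theor. Math. Phys. 17 (2013),
  §3 (the Shioda map `φ_B`, p. 8) and Thm. 3.1 (= G. Bini, Adv. Geom. 11 (2011), Thm. 3.1).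
  [Kelly2013]
* R. Kloosterman, *Zeta functions of monomial deformations of Delsarte hypersurfaces*, SIGMA 13
  (2017) 087, §2 (Def. 2.1, Lemma 2.4 and the surjections `Y*_λ → X*_λ`). [Kloosterman2017]
* R. Hartshorne, *Algebraic Geometry*, GTM 52 (1977): II Prop. 2.5, II Ex. 2.14, II Ex. 3.11(d),
  II Thm. 7.1. [Hartshorne1977]
-/

noncomputable section

open CategoryTheory AlgebraicGeometry MvPolynomial HomogeneousLocalization

universe u

namespace Literature.AlgebraicGeometry.Motives

namespace Delsarte.FermatCover

/-! ### §0 Algebra: Laurent monomial maps, the equation `w^B = z`, row sums of `B` -/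

section Algebra

variable {ι : Type*} [Fintype ι]

/-- `∏ᵢ a ^ fᵢ = a ^ Σᵢ fᵢ` for integer exponents in a commutative group. [folklore] -/
theorem prod_zpow_eq_zpow_finset_sum {G κ : Type*} [CommGroup G] (a : G) (s : Finset κ)
    (f : κ → ℤ) : ∏ i ∈ s, a ^ f i = a ^ ∑ i ∈ s, f i := by
  classical
  induction s using Finset.induction_on with
  | empty => simp
  | insert j s hj ih => rw [Finset.prod_insert hj, Finset.sum_insert hj, ih, zpow_add]

/-- **The Laurent monomial map `w ↦ w^B`** of an integer matrix `B` on a torus `Gᶥ`: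
`(w^B)ⱼ = ∏ₖ wₖ ^ bⱼₖ` (the Shioda map `φ_B` of Kelly 2013, §3, on coordinates).
[cite: Kelly2013, §3 (φ_B)] -/
def monoMap {G : Type*} [CommGroup G] (B : Matrix ι ι ℤ) (w : ι → G) : ι → G :=
  fun j => ∏ k, w k ^ B j k

/-- Unfolding of `monoMap`. [folklore] -/
theorem monoMap_apply {G : Type*} [CommGroup G] (B : Matrix ι ι ℤ) (w : ι → G) (j : ι) :
    monoMap B w j = ∏ k, w k ^ B j k := rfl

/-- `(w^C)^B = w^{B C}`: `monoMap B (monoMap C w) = monoMap (B * C) w`. [folklore] -/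
theorem monoMap_monoMap {G : Type*} [CommGroup G] (B C : Matrix ι ι ℤ) (w : ι → G) :
    monoMap B (monoMap C w) = monoMap (B * C) w := by
  funext j
  simp only [monoMap_apply]
  calc ∏ k, (∏ l, w l ^ C k l) ^ B j k
      = ∏ k, ∏ l, w l ^ (C k l * B j k) := by
        refine Finset.prod_congr rfl fun k _ => ?_
        rw [← Finset.prod_zpow]
        exact Finset.prod_congr rfl fun l _ => (zpow_mul _ _ _).symm
    _ = ∏ l, ∏ k, w l ^ (C k l * B j k) := Finset.prod_comm
    _ = ∏ l, w l ^ (B * C) j l := by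
        refine Finset.prod_congr rfl fun l _ => ?_
        rw [prod_zpow_eq_zpow_finset_sum, Matrix.mul_apply]
        exact congrArg _ (Finset.sum_congr rfl fun k _ => mul_comm _ _)

/-- `monoMap (c • 1) w = w ^ c` (componentwise). [folklore] -/
theorem monoMap_smul_one [DecidableEq ι] {G : Type*} [CommGroup G] (c : ℤ) (w : ι → G) :
    monoMap (c • (1 : Matrix ι ι ℤ)) w = fun j => w j ^ c := by
  funext j
  rw [monoMap_apply, Finset.prod_eq_single j]
  · simp
  · intro k _ hkj
    simp [hkj.symm]
  · simp

/-- **`F_A(w^B) = Σᵢ wᵢᵈ` when `A B = d · 1`** (point form of the Shioda substitution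
`Delsarte.bind₁_polynomial`; Kelly 2013, §3: `φ_B` restricts to `X_{dI} ⇢ X_A`).
[cite: Kelly2013, §3 (φ_B restricts to X_dI ⇢ X_A)] -/
theorem aeval_monoMap_polynomial [DecidableEq ι] {k : Type*} [Field k] {L : Type*} [CommRing L]
    [Algebra k L] (A : Matrix ι ι ℕ) (B : Matrix ι ι ℤ) {d : ℕ}
    (hAB : A.map (Nat.cast : ℕ → ℤ) * B = (d : ℤ) • (1 : Matrix ι ι ℤ)) (w : ι → Lˣ) :
    aeval (fun j => ((monoMap B w j : Lˣ) : L)) (polynomial k A) = ∑ i, ((w i : Lˣ) : L) ^ d := by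
  simp only [polynomial_def, map_sum, map_prod, map_pow, aeval_X]
  refine Finset.sum_congr rfl fun i _ => ?_
  have key : monoMap (A.map (Nat.cast : ℕ → ℤ)) (monoMap B w) i = w i ^ (d : ℤ) := by
    have h := congrFun (monoMap_monoMap (A.map (Nat.cast : ℕ → ℤ)) B w) i
    rw [hAB, monoMap_smul_one] at h
    exact h
  rw [monoMap_apply] at key
  have key' : (∏ j, (monoMap B w j) ^ (A i j)) = w i ^ d := by
    simpa only [Matrix.map_apply, zpow_natCast] using key
  rw [← Units.val_pow_eq_pow_val, ← key', Units.coe_prod]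
  simp only [Units.val_pow_eq_pow_val]

/-- `A B = d · 1` with `d ≠ 0` forces `det B ≠ 0` (and `det A ≠ 0`). [folklore] -/
theorem det_ne_zero_of_mul_eq [DecidableEq ι] {A B : Matrix ι ι ℤ} {d : ℤ} (hAB : A * B = d • (1 : Matrix ι ι ℤ))
    (hd : d ≠ 0) : B.det ≠ 0 ∧ A.det ≠ 0 := by
  have h : A.det * B.det = d ^ Fintype.card ι := by
    rw [← Matrix.det_mul, hAB, Matrix.det_smul, Matrix.det_one, mul_one]
  have hne : A.det * B.det ≠ 0 := h ▸ pow_ne_zero _ hd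
  exact ⟨right_ne_zero_of_mul hne, left_ne_zero_of_mul hne⟩

/-- **Solving `w^B = z` on a torus over an algebraically closed field**: if `det B ≠ 0`, every
`z ∈ (Lˣ)ᶥ` is `w^B` for some `w ∈ (Lˣ)ᶥ` — take `|det B|`-th roots `uⱼ` of the `zⱼ` and
`w = u^{± adj B}` (`B · adj B = det B · 1`). This is the surjectivity of `Y* → X*` on geometric
points (Kloosterman 2017, §2). [folklore] -/
theorem exists_monoMap_eq [DecidableEq ι] {L : Type*} [Field L] [IsAlgClosed L] (B : Matrix ι ι ℤ)
    (hB : B.det ≠ 0) (z : ι → Lˣ) : ∃ w : ι → Lˣ, monoMap B w = z := by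
  set e : ℕ := B.det.natAbs with he_def
  have he : 0 < e := Int.natAbs_pos.mpr hB
  have hroot : ∀ j, ∃ u : Lˣ, u ^ e = z j := fun j => by
    obtain ⟨x, hx⟩ := IsAlgClosed.exists_pow_nat_eq ((z j : Lˣ) : L) he
    have hx0 : x ≠ 0 := by
      rintro rfl
      rw [zero_pow he.ne'] at hx
      exact (z j).ne_zero hx.symm
    refine ⟨Units.mk0 x hx0, Units.ext ?_⟩
    rw [Units.val_pow_eq_pow_val, Units.val_mk0, hx]
  choose u hu using hroot
  refine ⟨monoMap (B.det.sign • B.adjugate) u, ?_⟩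
  rw [monoMap_monoMap, Matrix.mul_smul, Matrix.mul_adjugate, smul_smul, monoMap_smul_one]
  funext j
  rw [Int.sign_mul_self_eq_natAbs, ← he_def, zpow_natCast, hu]

/-- **The rows of `B` have a common sum** when `A B = d · 1`, `det`-regularity coming from `d ≠ 0`,
and the rows of `A` have the common sum `e ≠ 0`: `e · B𝟙 = d · 𝟙` (apply `A`, then `adj A`).
[folklore] -/
theorem rowSum_eq_rowSum [DecidableEq ι] {A : Matrix ι ι ℕ} {B : Matrix ι ι ℤ} {d : ℕ} {e : ℕ}
    (hAB : A.map (Nat.cast : ℕ → ℤ) * B = (d : ℤ) • (1 : Matrix ι ι ℤ)) (hd : d ≠ 0) (he : e ≠ 0)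
    (hrow : ∀ i, ∑ j, A i j = e) (j j' : ι) : ∑ k, B j k = ∑ k, B j' k := by
  set A' : Matrix ι ι ℤ := A.map (Nat.cast : ℕ → ℤ) with hA'
  have hA1 : A'.mulVec (1 : ι → ℤ) = (e : ℤ) • (1 : ι → ℤ) := by
    funext i
    simp only [Matrix.mulVec, dotProduct, Pi.one_apply, mul_one, Pi.smul_apply, smul_eq_mul,
      hA', Matrix.map_apply]
    rw [← Nat.cast_sum, hrow i]
  have hAB1 : A'.mulVec (B.mulVec (1 : ι → ℤ)) = (d : ℤ) • (1 : ι → ℤ) := by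
    rw [Matrix.mulVec_mulVec, hAB, Matrix.smul_mulVec, Matrix.one_mulVec]
  -- `A' (e • B𝟙) = A' (d • 𝟙)`
  have h1 : A'.mulVec ((e : ℤ) • B.mulVec (1 : ι → ℤ)) = A'.mulVec ((d : ℤ) • (1 : ι → ℤ)) := by
    rw [Matrix.mulVec_smul, hAB1, Matrix.mulVec_smul, hA1, smul_smul, smul_smul, mul_comm]
  -- cancel `A'` using the adjugate and `det A' ≠ 0`
  have hdet : A'.det ≠ 0 := (det_ne_zero_of_mul_eq hAB (by exact_mod_cast hd)).2
  have h2 : A'.det • ((e : ℤ) • B.mulVec (1 : ι → ℤ)) = A'.det • ((d : ℤ) • (1 : ι → ℤ)) := by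
    have h := congrArg (fun v => A'.adjugate.mulVec v) h1
    simp only [Matrix.mulVec_mulVec, Matrix.adjugate_mul, Matrix.smul_mulVec,
      Matrix.one_mulVec] at h
    exact h
  have h3 : (e : ℤ) • B.mulVec (1 : ι → ℤ) = (d : ℤ) • (1 : ι → ℤ) :=
    smul_right_injective (ι → ℤ) hdet h2
  have h4 : ∀ l, (e : ℤ) * ∑ k, B l k = d := fun l => by
    have h := congrFun h3 l
    simp only [Pi.smul_apply, smul_eq_mul, Matrix.mulVec, dotProduct, Pi.one_apply,
      mul_one] at h
    exact h
  exact mul_left_cancel₀ (by exact_mod_cast he) ((h4 j).trans (h4 j').symm)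

end Algebra

/-! ### §1 Density of the torus part of `V₊(F)` in `Proj k[x₀, …, x_{n+1}]` -/

section Density

variable {k : Type u} [Field k] {n : ℕ}

attribute [local instance] MvPolynomial.gradedAlgebra

local notation "𝒜" => MvPolynomial.homogeneousSubmodule (Fin (n + 2)) k

/-- The torus form `t = ∏ⱼ xⱼ`, whose basic open `D₊(t)` is the torus of `ℙⁿ⁺¹`. [folklore] -/
def torusForm (k : Type u) [Field k] (n : ℕ) : MvPolynomial (Fin (n + 2)) k := ∏ j, X j

/-- `t = ∏ⱼ xⱼ` is homogeneous of degree `n + 2`. [folklore] -/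
theorem torusForm_mem : torusForm k n ∈ 𝒜 (n + 2) := by
  have h := SetLike.prod_mem_graded 𝒜 (fun _ => (1 : ℕ))
    (fun j => (X j : MvPolynomial (Fin (n + 2)) k)) (F := (Finset.univ : Finset (Fin (n + 2))))
    (fun j _ => ProjectiveSpace.X_mem j)
  rw [Finset.sum_const, Finset.card_univ, Fintype.card_fin, smul_eq_mul, mul_one] at h
  exact h

/-- `t(z) = ∏ⱼ zⱼ`. [folklore] -/
theorem aeval_torusForm {S : Type*} [CommRing S] [Algebra k S] (z : Fin (n + 2) → S) :
    aeval z (torusForm k n) = ∏ j, z j := by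
  simp [torusForm, map_prod]

/-- A polynomial not vanishing at a point with `zⱼ = 0` is not divisible by `xⱼ`. [folklore] -/
theorem not_X_dvd_of_aeval_ne_zero {F : MvPolynomial (Fin (n + 2)) k} {j : Fin (n + 2)}
    (z : Fin (n + 2) → k) (hz : z j = 0) (hF : aeval z F ≠ 0) :
    ¬ (X j : MvPolynomial (Fin (n + 2)) k) ∣ F := by
  rintro ⟨G, rfl⟩
  rw [map_mul, aeval_X, hz, zero_mul] at hF
  exact hF rfl

/-- **The torus part of `V₊(F)` is dense in `V₊(F)`** for a non-zero form `F` divisible by no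
variable: every point `p ∈ V₊(F)` specialises from a point `q ∈ V₊(F) ∩ D₊(∏ xⱼ)`, namely the
homogeneous core of `(G)` for a prime factor `G ∈ 𝔭` of `F` (a relevant homogeneous prime with
`F ∈ q ⊆ 𝔭` and `∏ xⱼ ∉ q`, as `G ∣ ∏ xⱼ` would make `G` a variable dividing `F`). Hence every open
set meeting `V₊(F)` meets `V₊(F) ∩ D₊(∏ xⱼ)` (Hartshorne I Ex. 2.9 / II Ex. 2.9: components of a
hypersurface are the `V₊` of the prime factors). [folklore] -/
theorem exists_mem_zeroLocus_inter_basicOpen {F : MvPolynomial (Fin (n + 2)) k} {m : ℕ}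
    (hFm : F ∈ 𝒜 m) (hF0 : F ≠ 0) (hX : ∀ j, ¬ (X j : MvPolynomial (Fin (n + 2)) k) ∣ F)
    {p : Proj 𝒜} (hp : p ∈ ProjectiveSpectrum.zeroLocus 𝒜 ({F} : Set (MvPolynomial _ k)))
    {W : Set (Proj 𝒜)} (hW : IsOpen W) (hpW : p ∈ W) :
    ∃ q ∈ W, q ∈ ProjectiveSpectrum.zeroLocus 𝒜 ({F} : Set (MvPolynomial _ k)) ∧
      q ∈ Proj.basicOpen 𝒜 (torusForm k n) := by
  have hFp : F ∈ p.asHomogeneousIdeal := Set.singleton_subset_iff.mp hp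
  -- a prime factor `G` of `F` lying in `𝔭`
  obtain ⟨G, hGmem, hGp⟩ : ∃ G ∈ UniqueFactorizationMonoid.factors F,
      G ∈ p.asHomogeneousIdeal.toIdeal := by
    have hprod : (UniqueFactorizationMonoid.factors F).prod ∈ p.asHomogeneousIdeal.toIdeal := by
      obtain ⟨v, hv⟩ := (UniqueFactorizationMonoid.factors_prod hF0).symm
      rw [← hv]
      exact Ideal.mul_mem_right _ _ hFp
    exact (Ideal.IsPrime.multiset_prod_mem_iff_exists_mem p.isPrime _).mp hprod
  have hGprime : Prime G := UniqueFactorizationMonoid.prime_of_factor G hGmem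
  have hGdvd : G ∣ F := UniqueFactorizationMonoid.dvd_of_mem_factors hGmem
  -- `G` divides no variable
  have hGX : ∀ j, ¬ G ∣ (X j : MvPolynomial (Fin (n + 2)) k) := fun j hj => by
    obtain ⟨r, hr, h | h⟩ := dvd_X_iff_exists.mp hj
    · exact hGprime.not_unit (h ▸ hr.map C)
    · refine hX j (dvd_trans ⟨C r, ?_⟩ hGdvd)
      rw [h, smul_eq_C_mul, mul_comm]
  -- the point `q`: homogeneous core of the prime ideal `(G)`
  set I : Ideal (MvPolynomial (Fin (n + 2)) k) := Ideal.span {G} with hI_def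
  have hI : I.IsPrime := (Ideal.span_singleton_prime hGprime.ne_zero).mpr hGprime
  have hQI : (I.homogeneousCore 𝒜).toIdeal ≤ I := Ideal.toIdeal_homogeneousCore_le 𝒜 I
  have hGI : ∀ x, x ∈ I → G ∣ x := fun x hx => Ideal.mem_span_singleton.mp hx
  have hIp : I ≤ p.asHomogeneousIdeal.toIdeal := Ideal.span_le.mpr (Set.singleton_subset_iff.mpr hGp)
  let q : ProjectiveSpectrum 𝒜 :=
    { asHomogeneousIdeal := I.homogeneousCore 𝒜
      isPrime := hI.homogeneousCore
      not_irrelevant_le := fun h =>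
        hGX 0 (hGI _ (hQI (h (HomogeneousIdeal.mem_irrelevant_of_mem _ zero_lt_one
          (ProjectiveSpace.X_mem 0))))) }
  have hqp : q ≤ (p : ProjectiveSpectrum 𝒜) := by
    intro x hx
    exact hIp (hQI hx)
  refine ⟨q, ?_, ?_, ?_⟩
  · -- `p ∈ closure {q}` and `W` is an open neighbourhood of `p`
    have hcl : (p : ProjectiveSpectrum 𝒜) ∈ closure ({q} : Set (ProjectiveSpectrum 𝒜)) :=
      (ProjectiveSpectrum.le_iff_mem_closure _ q p).mp hqp
    obtain ⟨y, hyW, hyq⟩ := mem_closure_iff.mp hcl W hW hpW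
    have hyq' : y = q := hyq
    subst hyq'
    exact hyW
  · show ({F} : Set (MvPolynomial (Fin (n + 2)) k)) ⊆
      (I.homogeneousCore 𝒜 : Set (MvPolynomial (Fin (n + 2)) k))
    exact Set.singleton_subset_iff.mpr
      (Ideal.mem_homogeneousCore_of_homogeneous_of_mem ⟨m, hFm⟩ (Ideal.mem_span_singleton.mpr hGdvd))
  · rw [Proj.mem_basicOpen]
    intro ht
    have ht' : G ∣ ∏ j : Fin (n + 2), (X j : MvPolynomial (Fin (n + 2)) k) := hGI _ (hQI ht)
    obtain ⟨j, -, hj⟩ := hGprime.exists_mem_finset_dvd ht'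
    exact hGX j hj

/-- **Transport to a closed subscheme**: if `ι : Z → ℙⁿ⁺¹_k` is a closed immersion with image
`V₊(F)`, `F` a non-zero form divisible by no variable, then the torus part `ι⁻¹ D₊(∏ xⱼ)` is dense
in `Z` (`ι` is a homeomorphism onto `V₊(F)`). [folklore] -/
theorem dense_preimage_basicOpen_torusForm {F : MvPolynomial (Fin (n + 2)) k} {m : ℕ}
    (hFm : F ∈ 𝒜 m) (hF0 : F ≠ 0) (hX : ∀ j, ¬ (X j : MvPolynomial (Fin (n + 2)) k) ∣ F)
    {Z : Scheme.{u}} (ι : Z ⟶ Proj 𝒜) [IsClosedImmersion ι]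
    (hrange : Set.range ι.base = ProjectiveSpectrum.zeroLocus 𝒜 ({F} : Set (MvPolynomial _ k))) :
    Dense ((ι ⁻¹ᵁ Proj.basicOpen 𝒜 (torusForm k n) : Z.Opens) : Set Z) := by
  rw [dense_iff_inter_open]
  rintro O hO ⟨z, hz⟩
  obtain ⟨W, hW, rfl⟩ := ι.isClosedEmbedding.isInducing.isOpen_iff.mp hO
  have hp : ι.base z ∈ ProjectiveSpectrum.zeroLocus 𝒜 ({F} : Set (MvPolynomial _ k)) :=
    hrange ▸ Set.mem_range_self z
  obtain ⟨q, hqW, hqF, hqt⟩ := exists_mem_zeroLocus_inter_basicOpen hFm hF0 hX hp hW hz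
  obtain ⟨z', rfl⟩ : q ∈ Set.range ι.base := hrange ▸ hqF
  exact ⟨z', hqW, hqt⟩

/-! #### No variable divides the Fermat form or `F_A` (characteristic zero) -/

/-- The test vector `𝟙 - eⱼ` (zero at `j`, one elsewhere). [folklore] -/
def testVec (k : Type u) [Field k] (j : Fin (n + 2)) : Fin (n + 2) → k :=
  fun i => if i = j then 0 else 1

/-- The Fermat form at `𝟙 - eⱼ` is `n + 1 ≠ 0` (`d > 0`, characteristic zero). [folklore] -/
theorem aeval_testVec_fermat (j : Fin (n + 2)) {d : ℕ} (hd : 0 < d) :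
    aeval (testVec k j) (fermatPolynomial k n d) = ((n + 1 : ℕ) : k) := by
  simp only [fermatPolynomial, map_sum, map_pow, aeval_X, testVec]
  rw [← Finset.add_sum_erase _ _ (Finset.mem_univ j), if_pos rfl, zero_pow hd.ne', zero_add,
    Finset.sum_congr rfl fun x hx => by rw [if_neg (Finset.ne_of_mem_erase hx), one_pow],
    Finset.sum_const, Finset.card_erase_of_mem (Finset.mem_univ j), Finset.card_univ,
    Fintype.card_fin, nsmul_eq_mul, mul_one]
  rfl

/-- No variable divides the Fermat form `Σ xᵢᵈ` (`d > 0`, characteristic zero), and it is non-zero.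
[folklore] -/
theorem not_X_dvd_fermat [CharZero k] {d : ℕ} (hd : 0 < d) :
    fermatPolynomial k n d ≠ 0 ∧ ∀ j, ¬ (X j : MvPolynomial (Fin (n + 2)) k) ∣ fermatPolynomial k n d := by
  have hne : ∀ j : Fin (n + 2), aeval (testVec k j) (fermatPolynomial k n d) ≠ 0 := fun j => by
    rw [aeval_testVec_fermat j hd]
    exact Nat.cast_ne_zero.mpr (Nat.succ_ne_zero n)
  refine ⟨fun h => hne 0 (by rw [h, map_zero]), fun j => ?_⟩
  exact not_X_dvd_of_aeval_ne_zero (testVec k j) (by simp [testVec]) (hne j)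

/-- `F_A` at `𝟙 - eⱼ` counts the rows `i` with `aᵢⱼ = 0`. [folklore] -/
theorem aeval_testVec_polynomial (A : Matrix (Fin (n + 2)) (Fin (n + 2)) ℕ) (j : Fin (n + 2)) :
    aeval (testVec k j) (polynomial k A) =
      ((Finset.univ.filter fun i => A i j = 0).card : k) := by
  simp only [polynomial_def, map_sum, map_prod, map_pow, aeval_X, testVec]
  rw [← Finset.sum_boole]
  refine Finset.sum_congr rfl fun i _ => ?_
  rw [Finset.prod_eq_single j]
  · rw [if_pos rfl]
    by_cases h : A i j = 0
    · simp [h]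
    · simp [h, zero_pow h]
  · intro l _ hlj
    simp [hlj]
  · simp

/-- If every column of `A` has a zero then no variable divides `F_A` (characteristic zero), and
`F_A ≠ 0` (Kloosterman 2017, Def. 2.1: the column condition says that no `xⱼ` divides `F_A`, i.e.
`X*` is dense in `X`). [cite: Kloosterman2017, Def. 2.1 and §2] -/
theorem not_X_dvd_polynomial [CharZero k] (A : Matrix (Fin (n + 2)) (Fin (n + 2)) ℕ)
    (hcol : ∀ j, ∃ i, A i j = 0) :
    polynomial k A ≠ 0 ∧ ∀ j, ¬ (X j : MvPolynomial (Fin (n + 2)) k) ∣ polynomial k A := by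
  have hne : ∀ j : Fin (n + 2), aeval (testVec k j) (polynomial k A) ≠ 0 := fun j => by
    rw [aeval_testVec_polynomial A j, Nat.cast_ne_zero, ← pos_iff_ne_zero, Finset.card_pos]
    obtain ⟨i, hi⟩ := hcol j
    exact ⟨i, Finset.mem_filter.mpr ⟨Finset.mem_univ i, hi⟩⟩
  refine ⟨fun h => hne 0 (by rw [h, map_zero]), fun j => ?_⟩
  exact not_X_dvd_of_aeval_ne_zero (testVec k j) (by simp [testVec]) (hne j)

end Density

/-! ### §2 The Shioda map on the torus chart `D₊(∏ yⱼ) = Spec k[y]_{(∏ yⱼ)}` -/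

section Chart

variable {k : Type u} [Field k] {n : ℕ}

attribute [local instance] MvPolynomial.gradedAlgebra ProjBaseChange.algebraBase

local notation "𝒜" => MvPolynomial.homogeneousSubmodule (Fin (n + 2)) k

/-- `Σ_{l < n+2} K = K (n + 2)`. [folklore] -/
theorem sum_const_fin (K : ℕ) : ∑ _l : Fin (n + 2), K = K * (n + 2) := by
  rw [Finset.sum_const, Finset.card_univ, Fintype.card_fin, smul_eq_mul, mul_comm]

/-- A monomial `∏ xₗ ^ cₗ` of total degree `M (n + 2)` lies in `𝒜_{M · deg t}`. [folklore] -/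
theorem prod_X_pow_mem (c : Fin (n + 2) → ℕ) {M : ℕ} (hc : ∑ l, c l = M * (n + 2)) :
    (∏ l, (X l : MvPolynomial (Fin (n + 2)) k) ^ c l) ∈ 𝒜 (M • (n + 2)) := by
  have h := SetLike.prod_mem_graded 𝒜 (fun l => c l • (1 : ℕ))
    (fun l => (X l : MvPolynomial (Fin (n + 2)) k) ^ c l) (F := (Finset.univ : Finset (Fin (n + 2))))
    (fun l _ => SetLike.pow_mem_graded (c l) (ProjectiveSpace.X_mem l))
  simp only [smul_eq_mul, mul_one] at h
  rw [hc] at h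
  rw [smul_eq_mul]
  exact h

/-- **Monomial fractions** `y^c / t^M ∈ k[y]_{(t)}`, `t = ∏ yₗ`, `|c| = M (n + 2)`: the regular
functions on the torus chart `D₊(t)` (Hartshorne II Prop. 2.5(b)). [folklore] -/
def monFrac (c : Fin (n + 2) → ℕ) (M : ℕ) (hc : ∑ l, c l = M * (n + 2)) :
    Away 𝒜 (torusForm k n) :=
  Away.mk 𝒜 torusForm_mem M (∏ l, X l ^ c l) (prod_X_pow_mem c hc)

/-- The underlying fraction of `monFrac c M`. [folklore] -/
theorem val_monFrac (c : Fin (n + 2) → ℕ) (M : ℕ) (hc : ∑ l, c l = M * (n + 2)) :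
    (monFrac (k := k) c M hc).val =
      Localization.mk (∏ l, (X l : MvPolynomial (Fin (n + 2)) k) ^ c l)
        (⟨torusForm k n ^ M, M, rfl⟩ : Submonoid.powers (torusForm k n)) :=
  Away.val_mk ..

/-- `monFrac` only depends on the exponents (proof-irrelevance helper). [folklore] -/
theorem monFrac_congr {c c' : Fin (n + 2) → ℕ} {M M' : ℕ} (h : c = c') (h' : M = M')
    (hc : ∑ l, c l = M * (n + 2)) (hc' : ∑ l, c' l = M' * (n + 2)) :
    monFrac (k := k) c M hc = monFrac c' M' hc' := by
  subst h
  subst h'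
  rfl

/-- `(y^c / t^M) · (y^{c'} / t^{M'}) = y^{c + c'} / t^{M + M'}`. [folklore] -/
theorem monFrac_mul (c c' : Fin (n + 2) → ℕ) (M M' : ℕ) (hc : ∑ l, c l = M * (n + 2))
    (hc' : ∑ l, c' l = M' * (n + 2)) :
    monFrac (k := k) c M hc * monFrac c' M' hc' =
      monFrac (c + c') (M + M')
        (by rw [add_mul, ← hc, ← hc', ← Finset.sum_add_distrib]; rfl) := by
  apply val_injective
  rw [val_mul, val_monFrac, val_monFrac, val_monFrac, Localization.mk_mul]
  congr 1
  · rw [← Finset.prod_mul_distrib]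
    exact Finset.prod_congr rfl fun l _ => (pow_add _ _ _).symm
  · exact Subtype.ext (pow_add _ _ _).symm

/-- `y^{(K,…,K)} / t^K = t^K / t^K = 1`. [folklore] -/
theorem monFrac_const (K : ℕ) :
    monFrac (k := k) (n := n) (fun _ => K) K (sum_const_fin K) = 1 := by
  apply val_injective
  rw [val_monFrac, val_one, Finset.prod_pow]
  exact Localization.mk_self (⟨torusForm k n ^ K, K, rfl⟩ : Submonoid.powers (torusForm k n))

/-- **Monomial fractions are units** of `k[y]_{(t)}` (their inverses are again monomial
fractions: `t` is the product of all the variables). [folklore] -/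
theorem isUnit_monFrac (c : Fin (n + 2) → ℕ) (M : ℕ) (hc : ∑ l, c l = M * (n + 2)) :
    IsUnit (monFrac (k := k) c M hc) := by
  set K := M * (n + 2) with hK
  have hcK : ∀ l, c l ≤ K := fun l =>
    hc ▸ Finset.single_le_sum (fun i _ => Nat.zero_le (c i)) (Finset.mem_univ l)
  have hMK : M ≤ K := Nat.le_mul_of_pos_right M (Nat.succ_pos _)
  have hc' : ∑ l, (K - c l) = (K - M) * (n + 2) := by
    have h1 : ∑ l, (K - c l) + ∑ l, c l = ∑ _l : Fin (n + 2), K := by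
      rw [← Finset.sum_add_distrib]
      exact Finset.sum_congr rfl fun l _ => Nat.sub_add_cancel (hcK l)
    rw [sum_const_fin, hc] at h1
    rw [Nat.sub_mul]
    omega
  refine IsUnit.of_mul_eq_one (monFrac (fun l => K - c l) (K - M) hc') ?_
  rw [monFrac_mul]
  have hsum : (c + fun l => K - c l) = fun _ => K := funext fun l => Nat.add_sub_cancel' (hcK l)
  have hM : M + (K - M) = K := Nat.add_sub_cancel' hMK
  exact (monFrac_congr hsum hM _ _).trans (monFrac_const K)

/-- **Values of monomial fractions at points**: at `[w]` (`w ∈ (Lˣ)ⁿ⁺²`) the fraction `y^c / t^M`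
takes the value `∏ wₗ ^ (cₗ - M)` (`ProjectiveSpace.awayEval_mk`). [folklore] -/
theorem awayEval_monFrac {L : Type u} [Field L] [Algebra k L] (w : Fin (n + 2) → Lˣ)
    (hwt : aeval (fun l => ((w l : Lˣ) : L)) (torusForm k n) ≠ 0)
    (c : Fin (n + 2) → ℕ) (M : ℕ) (hc : ∑ l, c l = M * (n + 2)) :
    ProjectiveSpace.awayEval (fun l => ((w l : Lˣ) : L)) hwt (monFrac c M hc) =
      ((∏ l, w l ^ ((c l : ℤ) - M) : Lˣ) : L) := by
  rw [monFrac, ProjectiveSpace.awayEval_mk _ _ torusForm_mem]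
  simp only [map_prod, map_pow, aeval_X, aeval_torusForm]
  rw [Units.coe_prod]
  simp only [Units.val_zpow_eq_zpow_val]
  rw [Finset.prod_congr rfl fun l _ => zpow_sub₀ (w l).ne_zero _ _, Finset.prod_div_distrib,
    Finset.prod_zpow]
  simp only [zpow_natCast]

/-! #### The Shioda vector `vⱼ = ∏ₗ (yₗ / y₀) ^ bⱼₗ` -/

variable (B : Matrix (Fin (n + 2)) (Fin (n + 2)) ℤ) (δ : ℤ)

/-- A shift making all the exponents `bⱼₗ + S - δ[l = 0]` non-negative. [folklore] -/
def shiodaBound : ℕ := (∑ j, ∑ l, (B j l).natAbs) + δ.natAbs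

/-- `0 ≤ bⱼₗ + S - δ[l = 0]` for `S = shiodaBound B δ`. [folklore] -/
theorem shiodaBound_spec (j l : Fin (n + 2)) :
    0 ≤ B j l + (shiodaBound B δ : ℕ) - (if l = 0 then δ else 0) := by
  have h1 : -(B j l) ≤ ((B j l).natAbs : ℤ) := by
    have := Int.le_natAbs (a := -(B j l))
    rwa [Int.natAbs_neg] at this
  have h2 : ((B j l).natAbs : ℤ) ≤ ∑ j', ∑ l', ((B j' l').natAbs : ℤ) := by
    have h3 : ((B j l).natAbs : ℤ) ≤ ∑ l', ((B j l').natAbs : ℤ) :=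
      Finset.single_le_sum (f := fun l' => ((B j l').natAbs : ℤ)) (fun i _ => by positivity)
        (Finset.mem_univ l)
    exact h3.trans (Finset.single_le_sum (f := fun j' => ∑ l', ((B j' l').natAbs : ℤ))
      (fun i _ => by positivity) (Finset.mem_univ j))
  have h4 : (if l = 0 then δ else 0) ≤ (δ.natAbs : ℤ) := by
    split_ifs
    · exact Int.le_natAbs
    · positivity
  simp only [shiodaBound, Nat.cast_add, Nat.cast_sum]
  linarith

/-- The exponents `cⱼₗ = bⱼₗ + S - δ[l = 0] ∈ ℕ` of the Shioda vector. [folklore] -/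
def shiodaExp (j l : Fin (n + 2)) : ℕ :=
  Int.toNat (B j l + (shiodaBound B δ : ℕ) - (if l = 0 then δ else 0))

/-- `cⱼₗ = bⱼₗ + S - δ[l = 0]` as integers. [folklore] -/
theorem shiodaExp_cast (j l : Fin (n + 2)) :
    ((shiodaExp B δ j l : ℕ) : ℤ) = B j l + (shiodaBound B δ : ℕ) - (if l = 0 then δ else 0) :=
  Int.toNat_of_nonneg (shiodaBound_spec B δ j l)

variable {B δ} (hδ : ∀ j, ∑ l, B j l = δ)
include hδ

/-- When all rows of `B` sum to `δ`, `Σₗ cⱼₗ = S (n + 2)`. [folklore] -/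
theorem sum_shiodaExp (j : Fin (n + 2)) : ∑ l, shiodaExp B δ j l = shiodaBound B δ * (n + 2) := by
  have h : ((∑ l, shiodaExp B δ j l : ℕ) : ℤ) = ((shiodaBound B δ * (n + 2) : ℕ) : ℤ) := by
    push_cast
    simp only [shiodaExp_cast, Finset.sum_sub_distrib, Finset.sum_add_distrib, hδ j,
      Finset.sum_ite_eq', Finset.mem_univ, if_true, Finset.sum_const, Finset.card_univ,
      Fintype.card_fin, nsmul_eq_mul]
    push_cast
    ring
  exact_mod_cast h

variable (B δ) in
/-- **The Shioda vector** `v = (vⱼ)`, `vⱼ = y^{cⱼ} / t^S = ∏ₗ (yₗ / y₀) ^ bⱼₗ ∈ k[y]_{(t)}`: homogeneous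
coordinates, on the torus chart, of the Shioda map `y ↦ y^B` (Kelly 2013, §3), normalised by the
common factor `y₀^{-δ}`. [cite: Kelly2013, §3 (φ_B)] -/
def shiodaVec (j : Fin (n + 2)) : Away 𝒜 (torusForm k n) :=
  monFrac (shiodaExp B δ j) (shiodaBound B δ) (sum_shiodaExp hδ j)

/-- The coordinates of the Shioda vector are units of `k[y]_{(t)}`. [folklore] -/
theorem isUnit_shiodaVec (j : Fin (n + 2)) : IsUnit (shiodaVec (k := k) B δ hδ j) :=
  isUnit_monFrac _ _ _

/-- In particular `x₀(v) = v₀` is a unit, so `v` defines a morphism through the chart `D₊(x₀)`.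
[folklore] -/
theorem isUnit_aeval_shiodaVec_X :
    IsUnit (aeval (shiodaVec (k := k) B δ hδ) (X 0 : MvPolynomial (Fin (n + 2)) k)) := by
  rw [aeval_X]
  exact isUnit_shiodaVec hδ 0

/-- **Value of the Shioda vector at a point** `[w]` of the torus: `vⱼ(w) = w₀^{-δ} · (w^B)ⱼ`.
[folklore] -/
theorem awayEval_shiodaVec {L : Type u} [Field L] [Algebra k L] (w : Fin (n + 2) → Lˣ)
    (hwt : aeval (fun l => ((w l : Lˣ) : L)) (torusForm k n) ≠ 0) (j : Fin (n + 2)) :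
    ProjectiveSpace.awayEval (fun l => ((w l : Lˣ) : L)) hwt (shiodaVec B δ hδ j) =
      ((w 0 ^ (-δ) * monoMap B w j : Lˣ) : L) := by
  rw [shiodaVec, awayEval_monFrac]
  congr 1
  simp only [shiodaExp_cast]
  rw [monoMap_apply, Finset.prod_congr rfl fun l _ => by
    rw [show B j l + ((shiodaBound B δ : ℕ) : ℤ) - (if l = 0 then δ else 0) -
      ((shiodaBound B δ : ℕ) : ℤ) = -(if l = 0 then δ else 0) + B j l by ring, zpow_add],
    Finset.prod_mul_distrib, Finset.prod_eq_single (0 : Fin (n + 2)) (fun l _ hl => by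
      rw [if_neg hl, neg_zero, zpow_zero]) (fun h => absurd (Finset.mem_univ _) h), if_pos rfl]

variable (B δ) in
/-- **The Shioda map on the torus chart** `Spec k[y]_{(t)} → ℙⁿ⁺¹_k`, `[y] ↦ [v] = [y^B]`, a
`k`-morphism (`ProjectiveSpace.vecChartPoint` through the chart `D₊(x₀)`; Kelly 2013, §3, the
Shioda map `φ_B`, restricted to the torus where it is a morphism). [cite: Kelly2013, §3 (φ_B)] -/
def shiodaChart : specOver k (Away 𝒜 (torusForm k n)) ⟶ projectiveSpace (n + 1) k :=
  ProjectiveSpace.vecChartPoint (ProjectiveSpace.X_mem 0) one_pos (shiodaVec B δ hδ)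
    (isUnit_aeval_shiodaVec_X hδ)

omit hδ in
/-- `pointOfVec` only depends on the vector (proof-irrelevance helper). [folklore] -/
theorem pointOfVec_congr {L : Type u} [Field L] [Algebra k L] {z z' : Fin (n + 2) → L}
    (h : z = z') (hz : z ≠ 0) (hz' : z' ≠ 0) :
    ProjectiveSpace.pointOfVec k z hz = ProjectiveSpace.pointOfVec k z' hz' := by
  subst h
  rfl

omit hδ in
/-- A vector of units is non-zero. [folklore] -/
theorem units_ne_zero {L : Type u} [Field L] (w : Fin (n + 2) → Lˣ) :
    (fun l => ((w l : Lˣ) : L)) ≠ 0 := fun h =>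
  (w 0).ne_zero (congrFun h 0)

omit hδ in
/-- `t(w) ≠ 0` for a vector of units. [folklore] -/
theorem aeval_torusForm_units_ne_zero {L : Type u} [Field L] [Algebra k L] (w : Fin (n + 2) → Lˣ) :
    aeval (fun l => ((w l : Lˣ) : L)) (torusForm k n) ≠ 0 := by
  rw [aeval_torusForm]
  exact Finset.prod_ne_zero_iff.mpr fun l _ => (w l).ne_zero

/-- **`[w] ↦ [w^B]`**: on the `L`-point of the torus chart with homogeneous coordinates `w`
(all `wₗ ≠ 0`) the Shioda map takes the value `[w^B]` (functoriality of `vecChartPoint`,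
`awayEval_shiodaVec`, scaling invariance of homogeneous coordinates). [cite: Kelly2013, §3 (φ_B)] -/
theorem specOverOfAlgHom_awayEval_comp_shiodaChart {L : Type u} [Field L] [Algebra k L]
    (w : Fin (n + 2) → Lˣ) (hwt : aeval (fun l => ((w l : Lˣ) : L)) (torusForm k n) ≠ 0) :
    specOverOfAlgHom (ProjectiveSpace.awayEval (fun l => ((w l : Lˣ) : L)) hwt) ≫
        shiodaChart B δ hδ =
      ProjectiveSpace.pointOfVec k (fun j => ((monoMap B w j : Lˣ) : L))
        (units_ne_zero (monoMap B w)) := by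
  set ρ := ProjectiveSpace.awayEval (fun l => ((w l : Lˣ) : L)) hwt with hρ
  have hρv : IsUnit (aeval (fun j => ρ (shiodaVec B δ hδ j)) (X 0 : MvPolynomial (Fin (n + 2)) k)) :=
    ProjectiveSpace.isUnit_aeval_comp ρ (isUnit_aeval_shiodaVec_X hδ)
  have hval : (fun j => ρ (shiodaVec B δ hδ j)) =
      ((w 0 ^ (-δ) : Lˣ) : L) • fun j => ((monoMap B w j : Lˣ) : L) := by
    funext j
    rw [hρ, awayEval_shiodaVec hδ w hwt j, Pi.smul_apply, smul_eq_mul, Units.val_mul]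
  have hne : (fun j => ρ (shiodaVec B δ hδ j)) ≠ 0 := by
    rw [hval]
    exact smul_ne_zero (w 0 ^ (-δ)).ne_zero (units_ne_zero (monoMap B w))
  rw [shiodaChart, ProjectiveSpace.specOverOfAlgHom_comp_vecChartPoint ρ _ _ _ _ hρv,
    ProjectiveSpace.vecChartPoint_eq_chartPoint _ _ _ hρv.ne_zero,
    ← ProjectiveSpace.pointOfVec_eq_chartPoint _ hne,
    pointOfVec_congr hval hne (smul_ne_zero (w 0 ^ (-δ)).ne_zero (units_ne_zero (monoMap B w)))]
  exact ProjectiveSpace.pointOfVec_smul _ (units_ne_zero (monoMap B w)) _ (w 0 ^ (-δ)).ne_zero _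

end Chart

/-! ### §3 The rational map `Y ⇢ X` and the Fermat cover -/

section Cover

variable {k : Type u} [Field k] {n : ℕ}

attribute [local instance] MvPolynomial.gradedAlgebra ProjBaseChange.algebraBase

local notation "𝒜" => MvPolynomial.homogeneousSubmodule (Fin (n + 2)) k

/-! #### The Shioda map on the torus part of a closed subscheme of `ℙⁿ⁺¹` -/

/-- The Shioda map on the torus chart as a morphism of schemes `Spec k[y]_{(t)} → Proj k[x]`
(underlying morphism of `shiodaChart`, with its source and target spelled as `Spec` and `Proj`).
[cite: Kelly2013, §3 (φ_B)] -/
def shiodaChartHom {B : Matrix (Fin (n + 2)) (Fin (n + 2)) ℤ} {δ : ℤ} (hδ : ∀ j, ∑ l, B j l = δ) :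
    Spec (CommRingCat.of (Away 𝒜 (torusForm k n))) ⟶ Proj 𝒜 :=
  (shiodaChart B δ hδ).left

/-- The Shioda map on the torus chart is a morphism over `Spec k`. [folklore] -/
theorem shiodaChartHom_comp_projToSpec {B : Matrix (Fin (n + 2)) (Fin (n + 2)) ℤ} {δ : ℤ}
    (hδ : ∀ j, ∑ l, B j l = δ) :
    shiodaChartHom hδ ≫ ProjBaseChange.projToSpec (Fin (n + 2)) k =
      Spec.map (CommRingCat.ofHom (algebraMap k (Away 𝒜 (torusForm k n)))) :=
  Over.w (shiodaChart B δ hδ)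

/-- **`[w] ↦ [w^B]`** for the Shioda map on the torus chart, in terms of morphisms of schemes.
[cite: Kelly2013, §3 (φ_B)] -/
theorem specMap_awayEval_comp_shiodaChartHom {B : Matrix (Fin (n + 2)) (Fin (n + 2)) ℤ} {δ : ℤ}
    (hδ : ∀ j, ∑ l, B j l = δ) {L : Type u} [Field L] [Algebra k L] (w : Fin (n + 2) → Lˣ)
    (hwt : aeval (fun l => ((w l : Lˣ) : L)) (torusForm k n) ≠ 0) :
    Spec.map (CommRingCat.ofHom
        (ProjectiveSpace.awayEval (fun l => ((w l : Lˣ) : L)) hwt).toRingHom) ≫ shiodaChartHom hδ =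
      (ProjectiveSpace.pointOfVec k (fun j => ((monoMap B w j : Lˣ) : L))
        (units_ne_zero (monoMap B w))).left :=
  congrArg CommaMorphism.left (specOverOfAlgHom_awayEval_comp_shiodaChart hδ w hwt)

/-- The **torus part** `U = Z ∩ D₊(∏ yⱼ)` of a scheme `Z → ℙⁿ⁺¹_k` (Kloosterman 2017, §2:
`Y* = Y ∩ T`). [cite: Kloosterman2017, §2 (Y*)] -/
abbrev torusPart {Z : Scheme.{u}} (ι : Z ⟶ Proj 𝒜) : Z.Opens :=
  ι ⁻¹ᵁ Proj.basicOpen 𝒜 (torusForm k n)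

/-- **The Shioda map on the torus part**: `U → D₊(t) ≅ Spec k[y]_{(t)} → ℙⁿ⁺¹_k`, `[y] ↦ [y^B]`
(Kelly 2013, §3: the restriction of `φ_B` to `X_{dI}`). [cite: Kelly2013, §3 (φ_B restricted to X_dI)] -/
def shiodaOnTorusPart {Z : Scheme.{u}} (ι : Z ⟶ Proj 𝒜) {B : Matrix (Fin (n + 2)) (Fin (n + 2)) ℤ}
    {δ : ℤ} (hδ : ∀ j, ∑ l, B j l = δ) : (torusPart ι : Scheme.{u}) ⟶ Proj 𝒜 :=
  (ι ∣_ Proj.basicOpen 𝒜 (torusForm k n)) ≫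
    (Proj.basicOpenIsoSpec 𝒜 (torusForm k n) torusForm_mem (Nat.succ_pos _)).hom ≫
      shiodaChartHom hδ

/-- The Shioda map on the torus part is a morphism over `Spec k`. [folklore] -/
theorem shiodaOnTorusPart_comp_projToSpec {Z : Scheme.{u}} (ι : Z ⟶ Proj 𝒜)
    {B : Matrix (Fin (n + 2)) (Fin (n + 2)) ℤ} {δ : ℤ} (hδ : ∀ j, ∑ l, B j l = δ) :
    shiodaOnTorusPart ι hδ ≫ ProjBaseChange.projToSpec (Fin (n + 2)) k =
      (torusPart ι).ι ≫ ι ≫ ProjBaseChange.projToSpec (Fin (n + 2)) k := by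
  simp only [shiodaOnTorusPart, Category.assoc]
  rw [shiodaChartHom_comp_projToSpec,
    ← ProjBaseChange.awayι_projToSpec (Fin (n + 2)) torusForm_mem (Nat.succ_pos _),
    ← Proj.basicOpenIsoSpec_inv_ι]
  simp only [Category.assoc, Iso.hom_inv_id_assoc, morphismRestrict_ι_assoc]

/-- **`[w] ↦ [w^B]` on the torus part**: if an `L`-point `Q` of `U` has homogeneous coordinates `w`
in `ℙⁿ⁺¹` (all `wₗ ≠ 0`), its image under the Shioda map is `[w^B]` (through the chart
`D₊(t) ≅ Spec k[y]_{(t)}`, `Q` is `Spec` of evaluation at `w`). [cite: Kelly2013, §3 (φ_B)] -/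
theorem comp_shiodaOnTorusPart {Z : Scheme.{u}} (ι : Z ⟶ Proj 𝒜)
    {B : Matrix (Fin (n + 2)) (Fin (n + 2)) ℤ} {δ : ℤ} (hδ : ∀ j, ∑ l, B j l = δ)
    {L : Type u} [Field L] [Algebra k L]
    (Q : Spec (CommRingCat.of L) ⟶ (torusPart ι : Scheme.{u})) (w : Fin (n + 2) → Lˣ)
    (hQ : Q ≫ (torusPart ι).ι ≫ ι =
      (ProjectiveSpace.pointOfVec k (fun l => ((w l : Lˣ) : L)) (units_ne_zero w)).left) :
    Q ≫ shiodaOnTorusPart ι hδ =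
      (ProjectiveSpace.pointOfVec k (fun j => ((monoMap B w j : Lˣ) : L))
        (units_ne_zero (monoMap B w))).left := by
  have hwt := aeval_torusForm_units_ne_zero (k := k) w
  have h1 : Q ≫ (ι ∣_ Proj.basicOpen 𝒜 (torusForm k n)) ≫
      (Proj.basicOpenIsoSpec 𝒜 (torusForm k n) torusForm_mem (Nat.succ_pos _)).hom =
        Spec.map (CommRingCat.ofHom
          (ProjectiveSpace.awayEval (fun l => ((w l : Lˣ) : L)) hwt).toRingHom) := by
    rw [← cancel_mono (Proj.awayι 𝒜 (torusForm k n) torusForm_mem (Nat.succ_pos _))]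
    simp only [Category.assoc]
    rw [← Proj.basicOpenIsoSpec_inv_ι, Iso.hom_inv_id_assoc, morphismRestrict_ι, hQ,
      ProjectiveSpace.pointOfVec_eq_chartPoint _ (units_ne_zero w) torusForm_mem (Nat.succ_pos _)
        hwt]
    rfl
  calc Q ≫ shiodaOnTorusPart ι hδ
      = (Q ≫ (ι ∣_ Proj.basicOpen 𝒜 (torusForm k n)) ≫
          (Proj.basicOpenIsoSpec 𝒜 (torusForm k n) torusForm_mem (Nat.succ_pos _)).hom) ≫
            shiodaChartHom hδ := by
        simp only [shiodaOnTorusPart, Category.assoc]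
    _ = _ := by
        rw [h1]
        exact specMap_awayEval_comp_shiodaChartHom hδ w hwt

/-! #### Closed subschemes of `ℙⁿ⁺¹_k` and their points -/

/-- The underlying morphism `Y → Proj k[x₀, …, x_{n+1}]` of a `k`-morphism `Y → ℙⁿ⁺¹_k` (with the
target spelled as `Proj`). [folklore] -/
def toProjHom {Y : SchemeOver k} (ιY : Y ⟶ projectiveSpace (n + 1) k) : Y.left ⟶ Proj 𝒜 :=
  ιY.left

/-- `Y → ℙⁿ⁺¹_k → Spec k` is the structure morphism of `Y`. [folklore] -/
theorem toProjHom_comp_projToSpec {Y : SchemeOver k} (ιY : Y ⟶ projectiveSpace (n + 1) k) :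
    toProjHom ιY ≫ ProjBaseChange.projToSpec (Fin (n + 2)) k = Y.hom :=
  Over.w ιY

/-- **Points of the torus part have unit homogeneous coordinates**: for `Y ↪ ℙⁿ⁺¹_k` with image
`V₊(Σ yᵢᵈ)` and a point `u` of the torus part `U`, the `κ(u)`-point `Spec κ(u) → U → Y → ℙⁿ⁺¹` is
`[w]` for a vector of units `w` with `Σ wᵢᵈ = 0` (the `k`-algebra structure on `κ(u)` being read
off from the structure morphisms, Mathlib `Spec.preimage`; homogeneous coordinates by
`ProjectiveSpace.exists_eq_pointOfVec`). [folklore] -/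
theorem exists_point_of_mem_torusPart {Y : SchemeOver k} (ιY : Y ⟶ projectiveSpace (n + 1) k)
    {d : ℕ} (hd : 0 < d)
    (hYrange : Set.range ιY.left.base =
      ProjectiveSpectrum.zeroLocus 𝒜 ({fermatPolynomial k n d} : Set (MvPolynomial _ k)))
    (u : (torusPart (toProjHom ιY) : Scheme.{u})) :
    ∃ (K : Type u) (_ : Field K) (_ : Algebra k K) (w : Fin (n + 2) → Kˣ)
      (Q : Spec (CommRingCat.of K) ⟶ (torusPart (toProjHom ιY) : Scheme.{u})),
      Q.base (IsLocalRing.closedPoint K) = u ∧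
        aeval (fun l => ((w l : Kˣ) : K)) (fermatPolynomial k n d) = 0 ∧
          Q ≫ (torusPart (toProjHom ιY)).ι ≫ toProjHom ιY =
            (ProjectiveSpace.pointOfVec k (fun l => ((w l : Kˣ) : K)) (units_ne_zero w)).left := by
  let U : Y.left.Opens := torusPart (toProjHom ιY)
  let K : Type u := (U : Scheme.{u}).residueField u
  let Q : Spec (CommRingCat.of K) ⟶ (U : Scheme.{u}) := (U : Scheme.{u}).fromSpecResidueField u
  letI : Algebra k K := (Spec.preimage (Q ≫ U.ι ≫ Y.hom)).hom.toAlgebra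
  have hY := toProjHom_comp_projToSpec ιY
  let P : AlgPoints (projectiveSpace (n + 1) k) K :=
    AlgPoints.mk (Q ≫ U.ι ≫ toProjHom ιY) (by
      simp only [Category.assoc]
      show Q ≫ U.ι ≫ toProjHom ιY ≫ ProjBaseChange.projToSpec (Fin (n + 2)) k =
        Spec.map (CommRingCat.ofHom (algebraMap k K))
      rw [hY]
      exact (Spec.map_preimage _).symm)
  have hQu : Q.base (IsLocalRing.closedPoint K) = u := Scheme.fromSpecResidueField_apply u _
  obtain ⟨w₀, hw₀, hPw⟩ := ProjectiveSpace.exists_eq_pointOfVec P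
  -- the underlying point of `P` is `ιY u`
  have hpt : (ProjectiveSpace.pointOfVec k w₀ hw₀).pt = (toProjHom ιY).base u.1 := by
    rw [← hPw]
    show (toProjHom ιY).base (U.ι.base (Q.base (IsLocalRing.closedPoint K))) = _
    rw [hQu]
    rfl
  -- `Σ w₀ᵢᵈ = 0` and all coordinates of `w₀` are non-zero
  have hFw : aeval w₀ (fermatPolynomial k n d) = 0 := by
    rw [← ProjectiveSpace.pt_pointOfVec_mem_zeroLocus_iff w₀ hw₀ hd
      ((mem_homogeneousSubmodule d _).mpr (isHomogeneous_fermatPolynomial n d)), hpt]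
    show ιY.left.base u.1 ∈ _
    rw [← hYrange]
    exact Set.mem_range_self _
  have htw : aeval w₀ (torusForm k n) ≠ 0 := by
    rw [← ProjectiveSpace.pt_pointOfVec_mem_basicOpen_iff w₀ hw₀ (Nat.succ_pos _) torusForm_mem,
      hpt]
    exact u.2
  have hw0 : ∀ l, w₀ l ≠ 0 := fun l hl => htw (by
    rw [aeval_torusForm]
    exact Finset.prod_eq_zero (Finset.mem_univ l) hl)
  obtain ⟨w, hww⟩ : ∃ w : Fin (n + 2) → Kˣ, (fun l => ((w l : Kˣ) : K)) = w₀ :=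
    ⟨fun l => Units.mk0 (w₀ l) (hw0 l), rfl⟩
  have hleft : (ProjectiveSpace.pointOfVec k (fun l => ((w l : Kˣ) : K)) (units_ne_zero w)).left =
      Q ≫ U.ι ≫ toProjHom ιY := by
    rw [pointOfVec_congr hww (units_ne_zero w) hw₀, ← hPw]
    rfl
  refine ⟨K, inferInstance, inferInstance, w, Q, hQu, ?_, hleft.symm⟩
  rw [hww]
  exact hFw

/-- **The Shioda map sends the torus part of the Fermat variety into `V₊(F_A)`** (`A B = d · 1`):
a point `u ∈ U` has unit homogeneous coordinates `w` over `κ(u)` with `Σ wᵢᵈ = 0` and is sent to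
`[w^B]`, where `F_A(w^B) = Σ wᵢᵈ = 0` (Kelly 2013, §3: `φ_B` restricts to `X_{dI} ⇢ X_A`).
[cite: Kelly2013, §3 (φ_B restricts to X_dI ⇢ X_A)] -/
theorem shiodaOnTorusPart_mem_zeroLocus {Y : SchemeOver k} (ιY : Y ⟶ projectiveSpace (n + 1) k)
    {B : Matrix (Fin (n + 2)) (Fin (n + 2)) ℤ} {δ : ℤ} (hδ : ∀ j, ∑ l, B j l = δ)
    {d : ℕ} (hd : 0 < d)
    (hYrange : Set.range ιY.left.base =
      ProjectiveSpectrum.zeroLocus 𝒜 ({fermatPolynomial k n d} : Set (MvPolynomial _ k)))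
    (A : Matrix (Fin (n + 2)) (Fin (n + 2)) ℕ)
    (hAB : A.map (Nat.cast : ℕ → ℤ) * B = (d : ℤ) • (1 : Matrix _ _ ℤ)) {e : ℕ} (he : 0 < e)
    (hrow : ∀ i, ∑ j, A i j = e) (u : (torusPart (toProjHom ιY) : Scheme.{u})) :
    (shiodaOnTorusPart (toProjHom ιY) hδ).base u ∈
      ProjectiveSpectrum.zeroLocus 𝒜 ({polynomial k A} : Set (MvPolynomial _ k)) := by
  obtain ⟨K, _, _, w, Q, hQu, hFw, hQ⟩ := exists_point_of_mem_torusPart ιY hd hYrange u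
  have himg : (shiodaOnTorusPart (toProjHom ιY) hδ).base u =
      (ProjectiveSpace.pointOfVec k (fun j => ((monoMap B w j : Kˣ) : K))
        (units_ne_zero (monoMap B w))).pt := by
    rw [← hQu]
    show _ = (ProjectiveSpace.pointOfVec k (fun j => ((monoMap B w j : Kˣ) : K))
      (units_ne_zero (monoMap B w))).left.base (IsLocalRing.closedPoint K)
    rw [← comp_shiodaOnTorusPart (toProjHom ιY) hδ Q w hQ]
    rfl
  rw [himg]
  refine (ProjectiveSpace.pt_pointOfVec_mem_zeroLocus_iff _ _ he
    ((mem_homogeneousSubmodule e _).mpr (isHomogeneous_polynomial k hrow))).mpr ?_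
  rw [aeval_monoMap_polynomial A B hAB w]
  simpa [fermatPolynomial] using hFw

/-- **Every point of the torus part `X ∩ D₊(∏ xⱼ)` of `X = V₊(F_A)` is hit by the Shioda map**
from the torus part of the Fermat variety (Kloosterman 2017, §2: `Y* → X*` is surjective): over
the algebraic closure `L` of `κ(x)`, `x = [z]` with `z ∈ (Lˣ)ⁿ⁺²`, `z = w^B` is solvable,
`Σ wᵢᵈ = F_A(z) = 0`, and `[w]` is an `L`-point of `U` mapped to `[z]`.
[cite: Kloosterman2017, §2 (surjectivity of Y* → X* after Lemma 2.8)] -/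
theorem exists_comp_shiodaOnTorusPart_eq {Y : SchemeOver k} (ιY : Y ⟶ projectiveSpace (n + 1) k)
    [IsClosedImmersion ιY.left] {B : Matrix (Fin (n + 2)) (Fin (n + 2)) ℤ} {δ : ℤ}
    (hδ : ∀ j, ∑ l, B j l = δ) {d : ℕ} (hd : 0 < d)
    (hYrange : Set.range ιY.left.base =
      ProjectiveSpectrum.zeroLocus 𝒜 ({fermatPolynomial k n d} : Set (MvPolynomial _ k)))
    (A : Matrix (Fin (n + 2)) (Fin (n + 2)) ℕ)
    (hAB : A.map (Nat.cast : ℕ → ℤ) * B = (d : ℤ) • (1 : Matrix _ _ ℤ)) {e : ℕ} (he : 0 < e)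
    (hrow : ∀ i, ∑ j, A i j = e) {X : SchemeOver k} (ιX : X ⟶ projectiveSpace (n + 1) k)
    (hXrange : Set.range ιX.left.base =
      ProjectiveSpectrum.zeroLocus 𝒜 ({polynomial k A} : Set (MvPolynomial _ k)))
    (x : X.left) (hx : ιX.left.base x ∈ Proj.basicOpen 𝒜 (torusForm k n)) :
    ∃ (L : Type u) (_ : Field L) (Q : Spec (CommRingCat.of L) ⟶ (torusPart (toProjHom ιY) : Scheme.{u}))
      (Px : Spec (CommRingCat.of L) ⟶ X.left),
      Px.base (IsLocalRing.closedPoint L) = x ∧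
        Q ≫ shiodaOnTorusPart (toProjHom ιY) hδ = Px ≫ toProjHom ιX := by
  -- the geometric point over `x`
  let K : Type u := X.left.residueField x
  let L : Type u := AlgebraicClosure K
  letI : Algebra k L :=
    ((algebraMap K L).comp (Spec.preimage (X.left.fromSpecResidueField x ≫ X.hom)).hom).toAlgebra
  let Px : AlgPoints X L :=
    AlgPoints.mk (Spec.map (CommRingCat.ofHom (algebraMap K L)) ≫ X.left.fromSpecResidueField x) (by
      rw [Category.assoc, ← Spec.map_preimage (X.left.fromSpecResidueField x ≫ X.hom),
        ← Spec.map_comp]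
      rfl)
  have hPx : Px.left.base (IsLocalRing.closedPoint L) = x := by
    show (X.left.fromSpecResidueField x).base
      ((Spec.map (CommRingCat.ofHom (algebraMap K L))).base (IsLocalRing.closedPoint L)) = x
    exact Scheme.fromSpecResidueField_apply x _
  -- homogeneous coordinates `z` of `x`: all non-zero, with `F_A(z) = 0`
  obtain ⟨z₀, hz₀, hPz⟩ := ProjectiveSpace.exists_eq_pointOfVec (AlgPoints.map ιX Px)
  have hpt : (ProjectiveSpace.pointOfVec k z₀ hz₀).pt = ιX.left.base x := by
    rw [← hPz]
    show ιX.left.base (Px.left.base (IsLocalRing.closedPoint L)) = _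
    rw [hPx]
  have hFz : aeval z₀ (polynomial k A) = 0 := by
    rw [← ProjectiveSpace.pt_pointOfVec_mem_zeroLocus_iff z₀ hz₀ he
      ((mem_homogeneousSubmodule e _).mpr (isHomogeneous_polynomial k hrow)), hpt, ← hXrange]
    exact Set.mem_range_self _
  have htz : aeval z₀ (torusForm k n) ≠ 0 := by
    rw [← ProjectiveSpace.pt_pointOfVec_mem_basicOpen_iff z₀ hz₀ (Nat.succ_pos _) torusForm_mem,
      hpt]
    exact hx
  have hz0 : ∀ l, z₀ l ≠ 0 := fun l hl => htz (by
    rw [aeval_torusForm]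
    exact Finset.prod_eq_zero (Finset.mem_univ l) hl)
  obtain ⟨z, hzz⟩ : ∃ z : Fin (n + 2) → Lˣ, (fun l => ((z l : Lˣ) : L)) = z₀ :=
    ⟨fun l => Units.mk0 (z₀ l) (hz0 l), rfl⟩
  -- solve `w^B = z`
  have hBdet : B.det ≠ 0 := (det_ne_zero_of_mul_eq hAB (by exact_mod_cast hd.ne')).1
  obtain ⟨w, hw⟩ := exists_monoMap_eq B hBdet z
  have hmz : (fun j => ((monoMap B w j : Lˣ) : L)) = z₀ := by
    rw [hw]
    exact hzz
  -- `[w]` lies on `Y`, inside the torus part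
  have hFw : aeval (fun l => ((w l : Lˣ) : L)) (fermatPolynomial k n d) = 0 := by
    have h := aeval_monoMap_polynomial (k := k) A B hAB w
    rw [hmz, hFz] at h
    simpa [fermatPolynomial] using h.symm
  have hmemY : (ProjectiveSpace.pointOfVec k _ (units_ne_zero w)).pt ∈ Set.range ιY.left := by
    show _ ∈ Set.range ιY.left.base
    rw [hYrange]
    exact (ProjectiveSpace.pt_pointOfVec_mem_zeroLocus_iff _ _ hd
      ((mem_homogeneousSubmodule d _).mpr (isHomogeneous_fermatPolynomial n d))).mpr hFw
  let Qy : AlgPoints Y L := (ProjectiveSpace.pointOfVec k _ (units_ne_zero w)).liftClosed ιY hmemY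
  have hQy : AlgPoints.map ιY Qy = ProjectiveSpace.pointOfVec k _ (units_ne_zero w) :=
    AlgPoints.map_liftClosed ιY _ hmemY
  have hQyU : Qy.pt ∈ torusPart (toProjHom ιY) := by
    show (AlgPoints.map ιY Qy).pt ∈ Proj.basicOpen 𝒜 (torusForm k n)
    rw [hQy]
    exact (ProjectiveSpace.pt_pointOfVec_mem_basicOpen_iff _ _ (Nat.succ_pos _)
      torusForm_mem).mpr (aeval_torusForm_units_ne_zero w)
  have hrange : Set.range Qy.left ⊆ Set.range (torusPart (toProjHom ιY)).ι := by
    rw [Scheme.Opens.range_ι]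
    exact Qy.range_left_subset hQyU
  obtain ⟨Q, hQfac⟩ : ∃ Q : Spec (CommRingCat.of L) ⟶ (torusPart (toProjHom ιY) : Scheme.{u}),
      Q ≫ (torusPart (toProjHom ιY)).ι = Qy.left :=
    ⟨IsOpenImmersion.lift _ _ hrange, IsOpenImmersion.lift_fac _ _ hrange⟩
  have hQ : Q ≫ (torusPart (toProjHom ιY)).ι ≫ toProjHom ιY =
      (ProjectiveSpace.pointOfVec k (fun l => ((w l : Lˣ) : L)) (units_ne_zero w)).left := by
    rw [← Category.assoc, hQfac, ← hQy]
    rfl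
  refine ⟨L, inferInstance, Q, Px.left, hPx, ?_⟩
  rw [comp_shiodaOnTorusPart (toProjHom ιY) hδ Q w hQ, pointOfVec_congr hmz _ hz₀, ← hPz]
  rfl

/-- **The Fermat cover, for given closed immersions** (Shioda 1986; Bini 2011, Thm. 3.1 = Kelly
2013, Thm. 3.1; Kloosterman 2017, §2): for `A B = d · 1`, `A` with constant positive row sums and a
zero in each column, reduced `Y ↪ ℙⁿ⁺¹_k` with image `V₊(Σ yᵢᵈ)` and `X ↪ ℙⁿ⁺¹_k` closed with image
`V₊(F_A)` (`k` of characteristic zero), the Shioda map `y ↦ y^B` is a dominant rational map `Y ⇢ X`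
over `k`, defined on the dense torus part of `Y`. [cite: Kelly2013, Thm. 3.1 (= Bini2011 Thm. 3.1) and §3 (φ_B); Kloosterman2017 §2] -/
theorem exists_partialMap [CharZero k] {Y : SchemeOver k} (ιY : Y ⟶ projectiveSpace (n + 1) k)
    [IsReduced Y.left] [IsClosedImmersion ιY.left] {B : Matrix (Fin (n + 2)) (Fin (n + 2)) ℤ}
    {δ : ℤ} (hδ : ∀ j, ∑ l, B j l = δ) {d : ℕ} (hd : 0 < d)
    (hYrange : Set.range ιY.left.base =
      ProjectiveSpectrum.zeroLocus 𝒜 ({fermatPolynomial k n d} : Set (MvPolynomial _ k)))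
    (A : Matrix (Fin (n + 2)) (Fin (n + 2)) ℕ)
    (hAB : A.map (Nat.cast : ℕ → ℤ) * B = (d : ℤ) • (1 : Matrix _ _ ℤ))
    (hcol : ∀ j, ∃ i, A i j = 0) {e : ℕ} (he : 0 < e) (hrow : ∀ i, ∑ j, A i j = e)
    {X : SchemeOver k} (ιX : X ⟶ projectiveSpace (n + 1) k) [IsClosedImmersion ιX.left]
    (hXrange : Set.range ιX.left.base =
      ProjectiveSpectrum.zeroLocus 𝒜 ({polynomial k A} : Set (MvPolynomial _ k))) :
    ∃ f : Y.left.PartialMap X.left, IsDominant f.hom ∧ f.hom ≫ X.hom = f.domain.ι ≫ Y.hom := by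
  haveI : IsClosedImmersion (toProjHom ιY) := ‹IsClosedImmersion ιY.left›
  haveI : IsClosedImmersion (toProjHom ιX) := ‹IsClosedImmersion ιX.left›
  -- the Shioda map on the torus part of `Y` factors through the closed subscheme `X`
  have hsub : Set.range (shiodaOnTorusPart (toProjHom ιY) hδ) ⊆ Set.range (toProjHom ιX) := by
    rintro _ ⟨u, rfl⟩
    show _ ∈ Set.range ιX.left.base
    rw [hXrange]
    exact shiodaOnTorusPart_mem_zeroLocus ιY hδ hd hYrange A hAB he hrow u
  obtain ⟨fX, hfX⟩ : ∃ fX : (torusPart (toProjHom ιY) : Scheme.{u}) ⟶ X.left,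
      fX ≫ toProjHom ιX = shiodaOnTorusPart (toProjHom ιY) hδ :=
    ⟨liftOfRangeSubset (toProjHom ιX) (shiodaOnTorusPart (toProjHom ιY) hδ) hsub,
      liftOfRangeSubset_comp _ _ hsub⟩
  -- the torus part of `Y` is dense
  have hdense : Dense ((torusPart (toProjHom ιY) : Y.left.Opens) : Set Y.left) :=
    dense_preimage_basicOpen_torusForm ((mem_homogeneousSubmodule d _).mpr
      (isHomogeneous_fermatPolynomial n d)) (not_X_dvd_fermat hd).1 (not_X_dvd_fermat hd).2
      (toProjHom ιY) hYrange
  refine ⟨⟨torusPart (toProjHom ιY), hdense, fX⟩, ?_, ?_⟩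
  · -- dominance: the dense torus part of `X` lies in the image
    rw [isDominant_iff, DenseRange]
    have hXdense : Dense ((torusPart (toProjHom ιX) : X.left.Opens) : Set X.left) :=
      dense_preimage_basicOpen_torusForm ((mem_homogeneousSubmodule e _).mpr
        (isHomogeneous_polynomial k hrow)) (not_X_dvd_polynomial A hcol).1
        (not_X_dvd_polynomial A hcol).2 (toProjHom ιX) hXrange
    refine hXdense.mono ?_
    intro x hx
    obtain ⟨L, _, Q, Px, hPx, hQP⟩ :=
      exists_comp_shiodaOnTorusPart_eq ιY hδ hd hYrange A hAB he hrow ιX hXrange x hx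
    have hQf : Q ≫ fX = Px := by
      rw [← cancel_mono (toProjHom ιX), Category.assoc, hfX, hQP]
    exact ⟨Q.base (IsLocalRing.closedPoint L), by rw [← hPx, ← hQf]; rfl⟩
  · -- compatibility with the structure morphisms to `Spec k`
    show fX ≫ X.hom = (torusPart (toProjHom ιY)).ι ≫ Y.hom
    rw [← toProjHom_comp_projToSpec ιX, ← Category.assoc, hfX, ← toProjHom_comp_projToSpec ιY]
    exact shiodaOnTorusPart_comp_projToSpec (toProjHom ιY) hδ

end Cover

end Delsarte.FermatCover

/-- **Discharge of `DelsarteFermatCover`** (Shioda 1986; Bini 2011, Thm. 3.1 = Kelly 2013,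
Thm. 3.1: `X_A` is birational to a quotient of the Fermat variety `X_{dI}` through the Shioda map
`φ_B`, `x = y^B`; Kloosterman 2017, §2: `Y* → X*` is surjective): for `A B = d · 1`, `A` with
constant positive row sums and a zero in each column, the Shioda map is a dominant rational map of
`ℂ`-schemes from the Fermat variety `Y = V₊(Σ yᵢᵈ) ⊆ ℙⁿ⁺¹_ℂ` to the Delsarte hypersurface
`X = V₊(F_A)`. [cite: Kelly2013, Thm. 3.1 (= Bini2011 Thm. 3.1) and §3; Kloosterman2017 §2] -/
theorem DelsarteFermatCover_holds : DelsarteFermatCover := by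
  intro n d A B X Y hd hAB hcol hrow hX hY
  obtain ⟨e, he, hrow⟩ := hrow
  obtain ⟨hXred, ιX, hιX, hXrange⟩ := hX
  obtain ⟨hYred, ιY, hιY, hYrange⟩ := hY
  have hδ : ∀ j, ∑ l, B j l = ∑ l, B 0 l := fun j =>
    Delsarte.FermatCover.rowSum_eq_rowSum hAB hd.ne' he.ne' hrow j 0
  exact Delsarte.FermatCover.exists_partialMap ιY hδ hd hYrange A hAB hcol he hrow ιX hXrange

end Literature.AlgebraicGeometry.Motives

end
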